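import Summits.CriticalPhenomena.PercolationContinuityZ3.Theorems.Transplant.SkelFrmBChoiceCreep2
import Summits.CriticalPhenomena.PercolationContinuityZ3.Theorems.Transplant.SkelFrmBChoiceCellsV
import HarnessLib

/-!
# N2 (frames-only node `SamePDropOfSkeletonFrm₁`, OPEN) — (ζ″) under (R-44)/(R-45): THE FORWARD-ROOM SLOT VALUE OF RECORD **`NegB.hFR mk : CSlot`**,
# `hFR mk … I := cR2vW … mk I + HF I · s (oth I) + HK I`, the TIGHT AFFINE forward rooms (p5-g16 14:01:07Z: `hF := c + certified reach`): **`HF 1 = 54`,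
# `HK 1 = 2`** (y′-steps, felt on axis 0: `hF 1 := c 1 + 54·s₀ + 2`, certified by `hPRY_V : rdHi₀ ≤ c 1 + 54·s₀ + 1`, SkelFrmBChoiceRegionsYV) and **`HF 0 = 5`,
# `HK 0 = 2`** (x-steps, felt on axis 1: `hF 0 := c 0 + 5·s₁ + 2`; the `+2` carries the reading floors exactly) — lead g12 14:07:13Z / p3-g17's numeral line

The V cells of record read `NegB.fcellsV … (cR2W mk …) (hFR mk …)` (SkelFrmBChoiceCellsV: backward room `hB I := 2·r (oth I)`, forward room the truncated slot
`hFV (hFR mk …) I = min (hFR …) (2·r (oth I))`); the truncation is INACTIVE under `K ≥ Kmin = 200` (`hFR_le_two_r`: `c 1 + 54·s₀ + 2 ≤ 110·s₀ + 51·s₀ < 2K·s₀`,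
`c 0 + 5·s₁ + 2 ≤ 27·s₁ + 1 + 7·s₁ < 2K·s₁`), and `c I < hF I` (`cR2vW_lt_hFR`).  WHY these numerals: they are the TIGHT CERTIFIED forward reaches of the
corridors' habitats (p5-g16 14:01:07Z: the (C) habitat rows and hp-8's (F) feasibility row `ρ⊥ + 13·s⊥ + ε ≤ b⊥`, `ρ⊥ := hF∥ − c∥`, must read the SAME number):
y′: `hPRY_V : rdHi₀(every region box) ≤ c 1 + 54·s₀ + 1` (SkelFrmBChoiceRegionsYV, G = 96 with the parking set's symmetric growth), x: the phase boxes' row top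
`≤ c 0 + 5·s₁ + 1` (`habX_box_V`, SkelFrmBChoiceHabXW: p5's phase boxes with `L = ⌊3nℓ/U⌋ + 1`, `E₁ < 2P + dec₁`).
* `HF`, `HK`, `hFRv`, **`hFR mk : CSlot`**, `hFR_apply`, `hFRv_apply`, `hFRv_le_two_r` (`hKq : 5 ≤ Kq`), `cR2vW_lt_hFRv`, `fcellsV_hF_eq_hFRv` (the truncation is the identity).
NON-VACUITY: definitions + value rows at the closed tuple (`EqNumL`, the two box-slot floors, `5 ≤ Kq`).
builds on p205010 (kernel theorem, internal audit signed; external expert review pending) — nothing in this file uses p205010; NOTHING is claimed about the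
open node `SamePDropOfSkeletonFrm₁`.
Lane `prim-bschramm`, seat `prim-bschramm-stmt` (gen 21); helper file (`--supports stmt-CriticalPhenomena-4575 --as helper`).
[cite: KozmaNitzan2024, §4 Lemma 12 (pp. 23–25)] [cite: MartineauTassion2017, §4.3 (the cell lattice)]
-/

open scoped Classical

noncomputable section

namespace Summit.CriticalPhenomena.PercolationContinuityZ3.Theorems.Transplant

namespace PlanarSkeletonFrm

namespace NegB

open Literature.Probability.Percolation Literature.Probability.LatticeModels SimpleGraph KNCells
open Literature.Probability.Percolation.KozmaNitzan.Cells (oth oth_oth)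
open SkelConc (Consts)
open Neg

/-- **The forward-room multipliers** (fine cells `·s⊥` beyond the creep, per step axis): `HF 0 = 5` (x-steps), `HF 1 = 54` (y′-steps). [this work] -/
def HF (I : Fin 2) : ℕ := if I = 0 then 5 else 54

/-- **The forward-room floor constants** (fine units carrying the two reading floors): `HK 0 = 2`, `HK 1 = 2`. [this work] -/
def HK (I : Fin 2) : ℕ := if I = 0 then 2 else 2

/-- `HF 0 = 5`, `HF 1 = 54`, `HK 0 = 2`, `HK 1 = 2`. [folklore] -/
theorem HF_apply : HF 0 = 5 ∧ HF 1 = 54 ∧ HK 0 = 2 ∧ HK 1 = 2 := ⟨rfl, rfl, rfl, rfl⟩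

section Room

variable (κ : Consts) {V : Type} [DecidableEq V] [Countable V] {G : SimpleGraph V} [G.LocallyFinite] (Φ : PlanarSkeletonFrm G) (t : V) (p : unitInterval)
  (D : Skelφ.StepI.DataNS V) (g f mk : ℕ)

/-- **The forward-room value** `hFRv mk I := cR2vW mk I + HF I · s (oth I) + HK I` (fine cells; the step along `I` is felt on `oth I`). [this work] -/
def hFRv : Fin 2 → ℕ := fun I => cR2vW κ Φ t p D g f mk I + HF I * (fcellsA κ Φ t p D g f).s (oth I) + HK I

/-- `hFRv 0 = cRvW 0 + 5·s₁ + 2`, `hFRv 1 = cRvY3 + 54·s₀ + 2`. [folklore] -/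
theorem hFRv_apply : hFRv κ Φ t p D g f mk 0 = cRvW κ Φ t p D g f mk 0 + 5 * (fcellsA κ Φ t p D g f).s 1 + 2 ∧
    hFRv κ Φ t p D g f mk 1 = cRvY3 κ Φ t p D g f mk + 54 * (fcellsA κ Φ t p D g f).s 0 + 2 := by
  refine ⟨?_, ?_⟩
  · simp only [hFRv, (cR2vW_apply κ Φ t p D g f mk).1, HF_apply.1, HF_apply.2.2.1, show oth (0 : Fin 2) = 1 by decide]
  · simp only [hFRv, (cR2vW_apply κ Φ t p D g f mk).2, HF_apply.2.1, HF_apply.2.2.2, show oth (1 : Fin 2) = 0 by decide]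

/-- **The forward room fits twice the opposite half-side** (`K ≥ 200`): `hFRv I ≤ 2·r (oth I)` — so `hFV (hFRv …) = hFRv` (the truncation is inactive). [this work] -/
theorem hFRv_le_two_r (hKq : 5 ≤ Neg.Kq κ) (hN : EqNumL κ Φ t p D g f) (hg : gFloorKG κ Φ t p D mk ≤ g) (hg2 : 40 * Neg.K κ * KS0.R'0 κ Φ t p D mk ≤ g) :
    ∀ I, hFRv κ Φ t p D g f mk I ≤ 2 * (fcellsA κ Φ t p D g f).r (oth I) := by
  have hK200 : 200 ≤ Neg.K κ := by have := Neg.K_eq κ; omega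
  have hr : ∀ i, (((fcellsA κ Φ t p D g f).r i : ℕ) : ℤ) = (Neg.K κ : ℤ) * (((fcellsA κ Φ t p D g f).s i : ℕ) : ℤ) := fun i => by
    rw [PCells2.r_eq, show ((fcellsA κ Φ t p D g f).K : ℤ) = Neg.K κ by exact_mod_cast (fcellsA_K κ Φ t p D g f).1]
  have hK' : (200 : ℤ) ≤ Neg.K κ := by exact_mod_cast hK200
  intro I
  fin_cases I
  · -- x-steps: cRvW 0 ≤ 27·s₁ + 1, + 5·s₁ + 2 ≤ 2K·s₁
    show hFRv κ Φ t p D g f mk 0 ≤ 2 * (fcellsA κ Φ t p D g f).r (oth 0)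
    rw [(hFRv_apply κ Φ t p D g f mk).1, show oth (0 : Fin 2) = 1 by decide]
    obtain ⟨-, hhi, -, -, hle⟩ := rd1_bounds_W κ Φ t p D g f mk hN hg hg2
    obtain ⟨hc, -⟩ := cRvW_zero_eq κ Φ t p D g f mk hN hg hg2
    have hs1 : (1 : ℤ) ≤ (((fcellsA κ Φ t p D g f).s 1 : ℕ) : ℤ) := by exact_mod_cast (fcellsA κ Φ t p D g f).hs 1
    have hKs : 200 * (((fcellsA κ Φ t p D g f).s 1 : ℕ) : ℤ) ≤ (Neg.K κ : ℤ) * (((fcellsA κ Φ t p D g f).s 1 : ℕ) : ℤ) :=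
      mul_le_mul_of_nonneg_right hK' (by linarith)
    have key : ((cRvW κ Φ t p D g f mk 0 : ℕ) : ℤ) + 5 * (((fcellsA κ Φ t p D g f).s 1 : ℕ) : ℤ) + 2 ≤ 2 * (((fcellsA κ Φ t p D g f).r 1 : ℕ) : ℤ) := by
      rw [hc, hr 1]; unfold cmidW; omega
    exact_mod_cast key
  · -- y′-steps: cRvY3 ≤ 108·s₀, + 54·s₀ + 2 ≤ 2K·s₀
    show hFRv κ Φ t p D g f mk 1 ≤ 2 * (fcellsA κ Φ t p D g f).r (oth 1)
    rw [(hFRv_apply κ Φ t p D g f mk).2, show oth (1 : Fin 2) = 0 by decide]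
    obtain ⟨-, hc, -⟩ := cRvY3_le κ Φ t p D g f mk hKq hN hg hg2
    have hs0 : (1 : ℤ) ≤ (((fcellsA κ Φ t p D g f).s 0 : ℕ) : ℤ) := by exact_mod_cast (fcellsA κ Φ t p D g f).hs 0
    have hKs : 200 * (((fcellsA κ Φ t p D g f).s 0 : ℕ) : ℤ) ≤ (Neg.K κ : ℤ) * (((fcellsA κ Φ t p D g f).s 0 : ℕ) : ℤ) :=
      mul_le_mul_of_nonneg_right hK' (by linarith)
    have key : ((cRvY3 κ Φ t p D g f mk : ℕ) : ℤ) + 54 * (((fcellsA κ Φ t p D g f).s 0 : ℕ) : ℤ) + 2 ≤ 2 * (((fcellsA κ Φ t p D g f).r 0 : ℕ) : ℤ) := by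
      rw [hr 0]; linarith
    exact_mod_cast key

/-- **The creep lies strictly inside the forward room**: `cR2vW I < hFRv I`. [folklore] -/
theorem cR2vW_lt_hFRv (I : Fin 2) : cR2vW κ Φ t p D g f mk I < hFRv κ Φ t p D g f mk I := by
  have hs := (fcellsA κ Φ t p D g f).hs (oth I)
  unfold hFRv HF HK
  split_ifs <;> omega

/-- **The V cells' forward room IS the value** under the floors: `(fcellsV … c (hFRv …)).hF I = hFRv I`. [this work] -/
theorem fcellsV_hF_eq_hFRv (c : Fin 2 → ℕ) (hKq : 5 ≤ Neg.Kq κ) (hN : EqNumL κ Φ t p D g f) (hg : gFloorKG κ Φ t p D mk ≤ g)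
    (hg2 : 40 * Neg.K κ * KS0.R'0 κ Φ t p D mk ≤ g) (I : Fin 2) :
    (fcellsV κ Φ t p D g f c (hFRv κ Φ t p D g f mk)).hF I = hFRv κ Φ t p D g f mk I :=
  fcellsV_hF_eq κ Φ t p D g f c (hFRv κ Φ t p D g f mk) (hFRv_le_two_r κ Φ t p D g f mk hKq hN hg hg2) I

end Room

/-- **THE FORWARD-ROOM SLOT OF RECORD** `hFR mk : CSlot` (same type as the creep slot: the V cells read `fcellsV … (cv …) (hv …)`). [this work] -/
def hFR (mk : ℕ) : CSlot := fun κ _ _ _ _ _ Φ t p D g f => hFRv κ Φ t p D g f mk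

/-- `hFR` by name. [folklore] -/
theorem hFR_apply (mk : ℕ) (κ : Consts) {V : Type} [DecidableEq V] [Countable V] {G : SimpleGraph V} [G.LocallyFinite] (Φ : PlanarSkeletonFrm G) (t : V)
    (p : unitInterval) (D : Skelφ.StepI.DataNS V) (g f : ℕ) : hFR mk κ Φ t p D g f = hFRv κ Φ t p D g f mk := rfl

end NegB

end PlanarSkeletonFrm

end Summit.CriticalPhenomena.PercolationContinuityZ3.Theorems.Transplant

end
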